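import Summits.NavierStokesRegularity.FluidComputer.TubeTablePost18L
import HarnessLib

/-!
# Kernel run of the post-ramp box tube, chunks 18 … 23 (bp3 gen 16)

HONEST FRAMING: low prior, high value-of-information experiment on Tao's machine paradigm; NOT a
claim that NS blows up.

Kernel evaluations (`decide +kernel`; no `native_decide`, no extra axioms) of the in-tree tube checker
`runTube` (`P = 60`, 12 Taylor terms, cube `Rt`, read-out `CLt`) on the chunks `cPL 18 … cPL 23`
(= design chunks `cT 36 … cT 41`) of `TubeTablePost18L.lean`, each from the recorded boundary
state `sPL i` to `sPL (i+1)`.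

[cite: Tao2016AveragedNS, §5.5 Thm 5.3 (5.5)]
-/

namespace Summit.NavierStokesRegularity.FluidComputer

namespace TubeTablePost18L

open Literature.Analysis.FluidPDE.FluidComputer Literature.Analysis.FluidPDE.FluidComputer.TubeTable
open Literature.Analysis.FluidPDE.FluidComputer.ThresholdLevelTable (GIt)

set_option maxHeartbeats 10000000 in
set_option maxRecDepth 200000 in
/-- Chunk 18 of the post-ramp tube run (design chunk 36: 50 steps at `h = 2^-11`). [folklore] -/
theorem runPL_18 : runTube 60 12 GIt CLt Rt (sPL 18) (cPL 18) = some (sPL (18 + 1)) := by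
  decide +kernel

set_option maxHeartbeats 10000000 in
set_option maxRecDepth 200000 in
/-- Chunk 19 of the post-ramp tube run (design chunk 37: 50 steps at `h = 2^-11`). [folklore] -/
theorem runPL_19 : runTube 60 12 GIt CLt Rt (sPL 19) (cPL 19) = some (sPL (19 + 1)) := by
  decide +kernel

set_option maxHeartbeats 10000000 in
set_option maxRecDepth 200000 in
/-- Chunk 20 of the post-ramp tube run (design chunk 38: 50 steps at `h = 2^-11`). [folklore] -/
theorem runPL_20 : runTube 60 12 GIt CLt Rt (sPL 20) (cPL 20) = some (sPL (20 + 1)) := by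
  decide +kernel

set_option maxHeartbeats 10000000 in
set_option maxRecDepth 200000 in
/-- Chunk 21 of the post-ramp tube run (design chunk 39: 50 steps at `h = 2^-11`). [folklore] -/
theorem runPL_21 : runTube 60 12 GIt CLt Rt (sPL 21) (cPL 21) = some (sPL (21 + 1)) := by
  decide +kernel

set_option maxHeartbeats 10000000 in
set_option maxRecDepth 200000 in
/-- Chunk 22 of the post-ramp tube run (design chunk 40: 50 steps at `h = 2^-11`). [folklore] -/
theorem runPL_22 : runTube 60 12 GIt CLt Rt (sPL 22) (cPL 22) = some (sPL (22 + 1)) := by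
  decide +kernel

set_option maxHeartbeats 10000000 in
set_option maxRecDepth 200000 in
/-- Chunk 23 of the post-ramp tube run (design chunk 41: 50 steps at `h = 2^-11`). [folklore] -/
theorem runPL_23 : runTube 60 12 GIt CLt Rt (sPL 23) (cPL 23) = some (sPL (23 + 1)) := by
  decide +kernel

end TubeTablePost18L

end Summit.NavierStokesRegularity.FluidComputer
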